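import Literature.AlgebraicGeometry.Deformation.SmoothSchemeLiftObstructionCocycle
import HarnessLib

/-!
# Functoriality of the obstruction 2-cocycle along a morphism lifted chartwise (ring level, one overlap at a time)
# (Hartshorne, *Deformation Theory*, Remark 10.1.1 and the proof of Thm. 10.2; Illusie's functoriality of the obstruction)

Layer `Literature/AlgebraicGeometry/Deformation`, namespace `Literature.AlgebraicGeometry.Deformation.SmoothAffineDeformation`
(THEOREMS only: no definition, no instance, no notation, no named fact).  Sequel of ★ `SmoothSchemeLiftObstructionCocycle` §6,
which proves NATURALITY of the obstruction derivation `θ_D = ψ'₂₃ ψ'₁₂ ψ'₁₃⁻¹` under a `k`-algebra map `g : B₀ → B₁` when the lifted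
transition automorphisms on the two sides are EXACTLY `(1 ⊗ g)`-compatible (restriction to a smaller affine open).  For the
FUNCTORIALITY of the obstruction along a MORPHISM of deformations `f₀ : Y → X` over `A = A'/J` (Illusie: «the obstruction is
functorial»; the case needed by «abelian schemes are unobstructed», where `f₀` runs through the endomorphisms `[n]` of an abelian
scheme, [Oort1971] Thm. 2.2.1 / Illusie Thm. 8.5.23) the chartwise lifts `F : A' ⊗_k B₀ → A' ⊗_k B₁` of `f₀♯` to the trivial lifted
charts intertwine the lifted gluing data only MODULO `J` — the two sides were lifted independently.  The DEFECTS
`F ψ'ᵢⱼ − φ'ᵢⱼ F` on `1 ⊗ b` are `ι(εᵢⱼ b)` for `k`-linear `εᵢⱼ : B₀ → B₁ ⊗_k J` (an `f`-derivation, but only linearity is used), and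
the obstruction derivations are intertwined UP TO THE ČECH COBOUNDARY OF THE DEFECTS:

  `(g ⊗ 1)(D b) = D₁(g b) + ε₁₂ b + ε₂₃ b − ε₁₃ b`          (`obstructionDerivation_functorial`).

With `εᵢⱼ = 0` this is ★ `obstructionDerivation_naturality`.  The Čech bookkeeping over a cover (pull-back of the obstruction CLASS,
`df_*[o(Y)] = f^*[o(X)]` in `Ȟ²`) is NOT here.

Setting (as in ★ §2/§6): `k` a commutative ring; `A'` a `k`-algebra with ideals `J` (`J² = 0`) and `𝔫'` with `J𝔫' = 0` (the small
extension `𝔪_{A'} J = 0`; all transition automorphisms induce the identity modulo `𝔫'`); `B₀, B₁` `k`-algebras, `B₁` flat; the chart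
lift `F` reduces to `1 ⊗ g` modulo `𝔫'` (`F(1 ⊗ b) − 1 ⊗ g b ∈ 𝔫'(A' ⊗ B₁)`).

* §1 `algHom_idealTensorIncl` — such an `F` restricts to `ι₁ ∘ (g ⊗ 1)` on the coefficient module `J(A' ⊗ B₀) = ι₀(B₀ ⊗ J)`
  (because `J𝔫' = 0`);
* §2 the DEFECT `x ↦ F(ψ' x) − φ'(F x)` of a pair of automorphisms intertwined mod `J` on pure tensors: it is `J`-valued everywhere
  (`defect_mem_smul_top`), kills `𝔫'(A' ⊗ B₀)` (`defect_eq_zero_of_mem_smul`), hence is invariant under `ψ ≡ 1 (mod 𝔫')` on the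
  right (`defect_apply_of_sub_mem`) — the three uses of centrality;
* §3 **`obstructionDerivation_functorial`** — the identity displayed above.

Cell `hodgecm-mathlib` (D-0151), F-11 sub-line `Cruxes/HDel/Lines/F11SmoothRoadA` (crux stmt-HodgeConjecture-24835), α1 / J4-(iv) brick
(iv-1a) of `F0/P1b/p04/CENSUS-J4iv-Unobstructed.v0.F0P1bp04g0.md` (road (a′): functoriality along `[n]`); consumer: the Čech-level
functoriality file and then «abelian schemes are unobstructed».  HC_CM is proved only modulo the 7 printed citations until rung 0 closes —
nothing here bears on a summit statement.

## References
* [Hartshorne2010] R. Hartshorne, *Deformation Theory*, GTM 257, Springer (2010): Remark 10.1.1 (p. 80), Thm. 10.2 (a) and its proof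
  (p. 81), Cor. 10.3 (p. 82); Lemma 4.5 (p. 31) (held text `book:springernd-deformation-theory`).
* (prose only, not held) L. Illusie, in *Fundamental Algebraic Geometry: Grothendieck's FGA Explained*, AMS (2005), §8.5 (functoriality of
  the obstruction; abelian schemes are unobstructed); F. Oort, *Finite group schemes, local moduli for abelian varieties, and lifting
  problems*, Compositio Math. 23 (1971), §2.2 (acq-14961).
-/

noncomputable section

open TensorProduct

namespace Literature.AlgebraicGeometry.Deformation.SmoothAffineDeformation

variable {k : Type*} [CommRing k]
variable {A' : Type*} [CommRing A'] [Algebra k A']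
variable {B₀ : Type*} [CommRing B₀] [Algebra k B₀]
variable {B₁ : Type*} [CommRing B₁] [Algebra k B₁]
variable (J : Ideal A')

/-! ## §1 A chart lift `F ≡ 1 ⊗ g (mod 𝔫')` acts as `g ⊗ 1` on the coefficient module `J(A' ⊗ B₀)` -/

/-- **`F ∘ ι₀ = ι₁ ∘ (g ⊗ 1)`.**  An `A'`-algebra map `F : A' ⊗_k B₀ → A' ⊗_k B₁` reducing to `1 ⊗ g` modulo `𝔫'`
(`F(1 ⊗ b) − 1 ⊗ g(b) ∈ 𝔫'(A' ⊗_k B₁)`) restricts, on the coefficient module `ι₀(B₀ ⊗_k J) = J(A' ⊗_k B₀)`, to `g ⊗ 1` — because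
`J𝔫' = 0` kills the correction term. [cite: Hartshorne2010, Remark 10.1.1, p. 80] [cite: Hartshorne2010, Thm. 10.2 (proof), p. 81] -/
theorem algHom_idealTensorIncl {𝔫' : Ideal A'} (hJ𝔫 : J * 𝔫' = ⊥) (F : A' ⊗[k] B₀ →ₐ[A'] A' ⊗[k] B₁) (g : B₀ →ₐ[k] B₁)
    (hF : ∀ b : B₀, F ((1 : A') ⊗ₜ b) - (1 : A') ⊗ₜ g b ∈ 𝔫' • (⊤ : Submodule A' (A' ⊗[k] B₁)))
    (m : B₀ ⊗[k] ↥(J.restrictScalars k)) :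
    F (idealTensorIncl J m) = idealTensorIncl J (g.toLinearMap.rTensor _ m) := by
  induction m using TensorProduct.induction_on with
  | zero => simp
  | tmul b j =>
    rw [LinearMap.rTensor_tmul, idealTensorIncl_tmul, idealTensorIncl_tmul, AlgHom.toLinearMap_apply]
    have h1 : ((j : A') ⊗ₜ[k] b : A' ⊗[k] B₀) = (j : A') • ((1 : A') ⊗ₜ[k] b) := by
      rw [TensorProduct.smul_tmul', smul_eq_mul, mul_one]
    have h2 : ((j : A') ⊗ₜ[k] g b : A' ⊗[k] B₁) = (j : A') • ((1 : A') ⊗ₜ[k] g b) := by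
      rw [TensorProduct.smul_tmul', smul_eq_mul, mul_one]
    rw [h1, map_smul, h2]
    have hj : (j : A') ∈ J := j.2
    calc (j : A') • F ((1 : A') ⊗ₜ[k] b)
        = (j : A') • ((1 : A') ⊗ₜ[k] g b) + (j : A') • (F ((1 : A') ⊗ₜ[k] b) - (1 : A') ⊗ₜ[k] g b) := by
          rw [smul_sub, add_sub_cancel]
      _ = (j : A') • ((1 : A') ⊗ₜ[k] g b) := by
          rw [smul_eq_zero_of_mem_of_mem_smul_top hJ𝔫 hj (hF b), add_zero]
  | add x y hx hy => simp only [map_add, hx, hy]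

/-! ## §2 The defect of a pair of automorphisms intertwined modulo `J` -/

section Defect

variable {𝔫' : Ideal A'} (F : A' ⊗[k] B₀ →ₐ[A'] A' ⊗[k] B₁)
  (ψ' : A' ⊗[k] B₀ ≃ₐ[A'] A' ⊗[k] B₀) (φ' : A' ⊗[k] B₁ ≃ₐ[A'] A' ⊗[k] B₁)

/-- **The defect is `J`-valued everywhere.**  If `F ψ'` and `φ' F` agree modulo `J(A' ⊗_k B₁)` on the pure tensors `1 ⊗ b`, they
agree modulo `J(A' ⊗_k B₁)` everywhere (`A'`-linearity: `a ⊗ b = a · (1 ⊗ b)`). [cite: Hartshorne2010, Thm. 10.2 (proof), p. 81] -/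
theorem defect_mem_smul_top
    (hc : ∀ b : B₀, F (ψ' ((1 : A') ⊗ₜ b)) - φ' (F ((1 : A') ⊗ₜ b)) ∈ J • (⊤ : Submodule A' (A' ⊗[k] B₁)))
    (x : A' ⊗[k] B₀) : F (ψ' x) - φ' (F x) ∈ J • (⊤ : Submodule A' (A' ⊗[k] B₁)) := by
  induction x using TensorProduct.induction_on with
  | zero => simp
  | tmul a b =>
    have h : (a ⊗ₜ[k] b : A' ⊗[k] B₀) = a • ((1 : A') ⊗ₜ[k] b) := by
      rw [TensorProduct.smul_tmul', smul_eq_mul, mul_one]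
    rw [h, map_smul, map_smul, map_smul, map_smul, ← smul_sub]
    exact Submodule.smul_mem _ a (hc b)
  | add x y hx hy =>
    have h : F (ψ' (x + y)) - φ' (F (x + y)) = (F (ψ' x) - φ' (F x)) + (F (ψ' y) - φ' (F y)) := by
      simp only [map_add]; abel
    rw [h]
    exact Submodule.add_mem _ hx hy

/-- **The defect kills `𝔫'(A' ⊗_k B₀)`** (`J𝔫' = 0`; the defect is `A'`-linear with values in `J(A' ⊗_k B₁)`).
[cite: Hartshorne2010, Thm. 10.2 (proof), p. 81] -/
theorem defect_eq_zero_of_mem_smul (hJ𝔫 : J * 𝔫' = ⊥)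
    (hc : ∀ b : B₀, F (ψ' ((1 : A') ⊗ₜ b)) - φ' (F ((1 : A') ⊗ₜ b)) ∈ J • (⊤ : Submodule A' (A' ⊗[k] B₁)))
    {n : A' ⊗[k] B₀} (hn : n ∈ 𝔫' • (⊤ : Submodule A' (A' ⊗[k] B₀))) : F (ψ' n) - φ' (F n) = 0 := by
  refine Submodule.smul_induction_on hn (fun a ha y _ => ?_) (fun x y hx hy => ?_)
  · rw [map_smul, map_smul, map_smul, map_smul, ← smul_sub]
    exact smul_eq_zero_of_mem_of_mem_smul_top (by rwa [mul_comm] at hJ𝔫) ha (defect_mem_smul_top J F ψ' φ' hc y)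
  · have h : F (ψ' (x + y)) - φ' (F (x + y)) = (F (ψ' x) - φ' (F x)) + (F (ψ' y) - φ' (F y)) := by
      simp only [map_add]; abel
    rw [h, hx, hy, add_zero]

/-- **The defect is invariant under an automorphism `≡ 1 (mod 𝔫')` on the right**: if `ψ x − x ∈ 𝔫'(A' ⊗_k B₀)` then the defect takes
the same value at `ψ x` and at `x`. [cite: Hartshorne2010, Thm. 10.2 (proof), p. 81] -/
theorem defect_apply_of_sub_mem (hJ𝔫 : J * 𝔫' = ⊥)
    (hc : ∀ b : B₀, F (ψ' ((1 : A') ⊗ₜ b)) - φ' (F ((1 : A') ⊗ₜ b)) ∈ J • (⊤ : Submodule A' (A' ⊗[k] B₁)))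
    {x y : A' ⊗[k] B₀} (hxy : y - x ∈ 𝔫' • (⊤ : Submodule A' (A' ⊗[k] B₀))) :
    F (ψ' y) - φ' (F y) = F (ψ' x) - φ' (F x) := by
  have h := defect_eq_zero_of_mem_smul J F ψ' φ' hJ𝔫 hc hxy
  have e : F (ψ' y) - φ' (F y) = (F (ψ' x) - φ' (F x)) + (F (ψ' (y - x)) - φ' (F (y - x))) := by
    simp only [map_sub]; abel
  rw [e, h, add_zero]

end Defect

/-- The inverse of an automorphism inducing the identity modulo `𝔫'` induces the identity modulo `𝔫'`.
[cite: Hartshorne2010, Thm. 10.2 (proof), p. 81] -/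
theorem inv_apply_sub_mem {𝔫' : Ideal A'} (ψ' : A' ⊗[k] B₀ ≃ₐ[A'] A' ⊗[k] B₀)
    (hψ' : ∀ x, ψ' x - x ∈ 𝔫' • (⊤ : Submodule A' (A' ⊗[k] B₀))) (x : A' ⊗[k] B₀) :
    ψ'⁻¹ x - x ∈ 𝔫' • (⊤ : Submodule A' (A' ⊗[k] B₀)) := by
  have h := hψ' (ψ'⁻¹ x)
  rw [← AlgEquiv.mul_apply, mul_inv_cancel, AlgEquiv.one_apply] at h
  rw [← Submodule.neg_mem_iff, neg_sub]
  exact h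

/-! ## §3 Functoriality of the obstruction derivation -/

/-- **FUNCTORIALITY OF THE OBSTRUCTION DERIVATION along a chartwise-lifted morphism** (Illusie: «the obstruction is functorial»).  Let `F : A' ⊗_k B₀ → A' ⊗_k B₁` be an `A'`-algebra map reducing to `1 ⊗ g` modulo `𝔫'`, let `ψ'ᵢⱼ` (on `B₀`) and
`φ'ᵢⱼ` (on `B₁`) be lifted transition automorphisms inducing the identity modulo `𝔫'` (`J𝔫' = 0`, `J² = 0`), intertwined by `F`
MODULO `J` with defects `εᵢⱼ`: `F(ψ'ᵢⱼ(1 ⊗ b)) = φ'ᵢⱼ(F(1 ⊗ b)) + ι(εᵢⱼ b)`.  Then the obstruction derivations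
`θ_D = ψ'₂₃ψ'₁₂ψ'₁₃⁻¹`, `θ_{D₁} = φ'₂₃φ'₁₂φ'₁₃⁻¹` satisfy
**`(g ⊗ 1)(D b) = D₁(g b) + ε₁₂ b + ε₂₃ b − ε₁₃ b`** — the pull-back of the obstruction of `X` and the push-forward of the
obstruction of `Y` differ by the Čech coboundary of the defect cochain (`B₁` flat over `k`).  With `ε = 0`: ★
`obstructionDerivation_naturality`. [cite: Hartshorne2010, Thm. 10.2 (proof), p. 81] [cite: Hartshorne2010, Remark 10.1.1, p. 80]
[cite: Hartshorne2010, Cor. 10.3, p. 82] -/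
theorem obstructionDerivation_functorial [Module.Flat k B₁] (hJ : J * J = ⊥) {𝔫' : Ideal A'} (hJ𝔫 : J * 𝔫' = ⊥)
    (F : A' ⊗[k] B₀ →ₐ[A'] A' ⊗[k] B₁) (g : B₀ →ₐ[k] B₁)
    (hF : ∀ b : B₀, F ((1 : A') ⊗ₜ b) - (1 : A') ⊗ₜ g b ∈ 𝔫' • (⊤ : Submodule A' (A' ⊗[k] B₁)))
    {ψ'₁₂ ψ'₂₃ ψ'₁₃ : A' ⊗[k] B₀ ≃ₐ[A'] A' ⊗[k] B₀} {φ'₁₂ φ'₂₃ φ'₁₃ : A' ⊗[k] B₁ ≃ₐ[A'] A' ⊗[k] B₁}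
    (hψ₁₂ : ∀ x, ψ'₁₂ x - x ∈ 𝔫' • (⊤ : Submodule A' (A' ⊗[k] B₀)))
    (hψ₁₃ : ∀ x, ψ'₁₃ x - x ∈ 𝔫' • (⊤ : Submodule A' (A' ⊗[k] B₀)))
    (hφ₁₂ : ∀ x, φ'₁₂ x - x ∈ 𝔫' • (⊤ : Submodule A' (A' ⊗[k] B₁)))
    (hφ₂₃ : ∀ x, φ'₂₃ x - x ∈ 𝔫' • (⊤ : Submodule A' (A' ⊗[k] B₁)))
    (hφ₁₃ : ∀ x, φ'₁₃ x - x ∈ 𝔫' • (⊤ : Submodule A' (A' ⊗[k] B₁)))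
    (ε₁₂ ε₂₃ ε₁₃ : B₀ →ₗ[k] B₁ ⊗[k] ↥(J.restrictScalars k))
    (hc₁₂ : ∀ b : B₀, F (ψ'₁₂ ((1 : A') ⊗ₜ b)) = φ'₁₂ (F ((1 : A') ⊗ₜ b)) + idealTensorIncl J (ε₁₂ b))
    (hc₂₃ : ∀ b : B₀, F (ψ'₂₃ ((1 : A') ⊗ₜ b)) = φ'₂₃ (F ((1 : A') ⊗ₜ b)) + idealTensorIncl J (ε₂₃ b))
    (hc₁₃ : ∀ b : B₀, F (ψ'₁₃ ((1 : A') ⊗ₜ b)) = φ'₁₃ (F ((1 : A') ⊗ₜ b)) + idealTensorIncl J (ε₁₃ b))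
    {D : Derivation k B₀ (B₀ ⊗[k] ↥(J.restrictScalars k))} {D₁ : Derivation k B₁ (B₁ ⊗[k] ↥(J.restrictScalars k))}
    (hD : infinitesimalAut J hJ D = ψ'₂₃ * ψ'₁₂ * ψ'₁₃⁻¹) (hD₁ : infinitesimalAut J hJ D₁ = φ'₂₃ * φ'₁₂ * φ'₁₃⁻¹)
    (b : B₀) :
    g.toLinearMap.rTensor _ (D b) = D₁ (g b) + ε₁₂ b + ε₂₃ b - ε₁₃ b := by
  -- the defects are `J`-valued on pure tensors
  have hJmem : ∀ (ε : B₀ →ₗ[k] B₁ ⊗[k] ↥(J.restrictScalars k)) (b : B₀),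
      idealTensorIncl J (ε b) ∈ J • (⊤ : Submodule A' (A' ⊗[k] B₁)) := fun ε b => idealTensorIncl_mem J (ε b)
  have hc₁₂' : ∀ b : B₀, F (ψ'₁₂ ((1 : A') ⊗ₜ b)) - φ'₁₂ (F ((1 : A') ⊗ₜ b)) ∈
      J • (⊤ : Submodule A' (A' ⊗[k] B₁)) := fun b => by rw [hc₁₂, add_sub_cancel_left]; exact hJmem ε₁₂ b
  have hc₂₃' : ∀ b : B₀, F (ψ'₂₃ ((1 : A') ⊗ₜ b)) - φ'₂₃ (F ((1 : A') ⊗ₜ b)) ∈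
      J • (⊤ : Submodule A' (A' ⊗[k] B₁)) := fun b => by rw [hc₂₃, add_sub_cancel_left]; exact hJmem ε₂₃ b
  have hc₁₃' : ∀ b : B₀, F (ψ'₁₃ ((1 : A') ⊗ₜ b)) - φ'₁₃ (F ((1 : A') ⊗ₜ b)) ∈
      J • (⊤ : Submodule A' (A' ⊗[k] B₁)) := fun b => by rw [hc₁₃, add_sub_cancel_left]; exact hJmem ε₁₃ b
  set x : A' ⊗[k] B₀ := (1 : A') ⊗ₜ b with hx
  -- `y₃ := ψ'₁₃⁻¹ x`, `y₂ := ψ'₁₂ y₃`; both `≡ x (mod 𝔫')`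
  have hy₃ : ψ'₁₃⁻¹ x - x ∈ 𝔫' • (⊤ : Submodule A' (A' ⊗[k] B₀)) := inv_apply_sub_mem ψ'₁₃ hψ₁₃ x
  have hy₂ : ψ'₁₂ (ψ'₁₃⁻¹ x) - x ∈ 𝔫' • (⊤ : Submodule A' (A' ⊗[k] B₀)) := by
    have e : ψ'₁₂ (ψ'₁₃⁻¹ x) - x = (ψ'₁₂ (ψ'₁₃⁻¹ x) - ψ'₁₃⁻¹ x) + (ψ'₁₃⁻¹ x - x) := by abel
    rw [e]; exact Submodule.add_mem _ (hψ₁₂ _) hy₃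
  -- step 3: `F y₃ = φ'₁₃⁻¹ (F x) - ι(ε₁₃ b)`
  have h13 : F (ψ'₁₃ (ψ'₁₃⁻¹ x)) - φ'₁₃ (F (ψ'₁₃⁻¹ x)) = idealTensorIncl J (ε₁₃ b) := by
    rw [defect_apply_of_sub_mem J F ψ'₁₃ φ'₁₃ hJ𝔫 hc₁₃' hy₃, hx, hc₁₃, add_sub_cancel_left]
  rw [← AlgEquiv.mul_apply, mul_inv_cancel, AlgEquiv.one_apply] at h13
  have hFy₃ : F (ψ'₁₃⁻¹ x) = φ'₁₃⁻¹ (F x) - idealTensorIncl J (ε₁₃ b) := by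
    have e1 : φ'₁₃ (F (ψ'₁₃⁻¹ x)) = F x - idealTensorIncl J (ε₁₃ b) := by rw [← h13]; abel
    have e2 : F (ψ'₁₃⁻¹ x) = φ'₁₃⁻¹ (F x - idealTensorIncl J (ε₁₃ b)) := by
      rw [show (φ'₁₃⁻¹ : A' ⊗[k] B₁ ≃ₐ[A'] A' ⊗[k] B₁) = φ'₁₃.symm from AlgEquiv.aut_inv φ'₁₃,
        AlgEquiv.eq_symm_apply]
      exact e1
    rw [e2, map_sub, apply_eq_self_of_mem_smul J hJ𝔫 φ'₁₃⁻¹ (inv_apply_sub_mem φ'₁₃ hφ₁₃) (hJmem ε₁₃ b)]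
  -- step 2: `F y₂ = φ'₁₂ (F y₃) + ι(ε₁₂ b)`
  have hFy₂ : F (ψ'₁₂ (ψ'₁₃⁻¹ x)) = φ'₁₂ (F (ψ'₁₃⁻¹ x)) + idealTensorIncl J (ε₁₂ b) := by
    have h := defect_apply_of_sub_mem J F ψ'₁₂ φ'₁₂ hJ𝔫 hc₁₂' hy₃
    rw [hx, hc₁₂, add_sub_cancel_left, ← hx] at h
    rw [← h]; abel
  -- step 1: `F (ψ'₂₃ y₂) = φ'₂₃ (F y₂) + ι(ε₂₃ b)`
  have hFy₁ : F (ψ'₂₃ (ψ'₁₂ (ψ'₁₃⁻¹ x))) = φ'₂₃ (F (ψ'₁₂ (ψ'₁₃⁻¹ x))) + idealTensorIncl J (ε₂₃ b) := by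
    have h := defect_apply_of_sub_mem J F ψ'₂₃ φ'₂₃ hJ𝔫 hc₂₃' hy₂
    rw [hx, hc₂₃, add_sub_cancel_left, ← hx] at h
    rw [← h]; abel
  -- assemble `F (θ_D x) = θ_{D₁} (F x) + ι(ε₁₂ b + ε₂₃ b - ε₁₃ b)`
  have hθ : F (infinitesimalAut J hJ D x) =
      infinitesimalAut J hJ D₁ (F x) + idealTensorIncl J (ε₁₂ b + ε₂₃ b - ε₁₃ b) := by
    rw [hD, hD₁, AlgEquiv.mul_apply, AlgEquiv.mul_apply, AlgEquiv.mul_apply, AlgEquiv.mul_apply, hFy₁, hFy₂, hFy₃,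
      map_sub, map_add, map_sub,
      apply_eq_self_of_mem_smul J hJ𝔫 φ'₁₂ hφ₁₂ (hJmem ε₁₃ b),
      apply_eq_self_of_mem_smul J hJ𝔫 φ'₂₃ hφ₂₃ (hJmem ε₁₃ b),
      apply_eq_self_of_mem_smul J hJ𝔫 φ'₂₃ hφ₂₃ (hJmem ε₁₂ b), map_sub, map_add]
    abel
  -- read both sides on `x = 1 ⊗ b`
  have hL : F (infinitesimalAut J hJ D x) = F x + idealTensorIncl J (g.toLinearMap.rTensor _ (D b)) := by
    rw [hx, infinitesimalAut_one_tmul, map_add, algHom_idealTensorIncl J hJ𝔫 F g hF]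
  have hR : infinitesimalAut J hJ D₁ (F x) = F x + idealTensorIncl J (D₁ (g b)) := by
    have e : F x = (1 : A') ⊗ₜ g b + (F x - (1 : A') ⊗ₜ g b) := by abel
    rw [infinitesimalAut_apply, add_right_inj, e, map_add, derivationExtension_tmul, one_smul,
      derivationExtension_apply_eq_zero_of_mem_smul J hJ𝔫 D₁ (hF b), add_zero]
  rw [hL, hR, add_assoc, add_right_inj, ← map_add] at hθ
  have := idealTensorIncl_injective (A' := A') J hθ
  rw [this]
  abel

end Literature.AlgebraicGeometry.Deformation.SmoothAffineDeformation

end
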